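import Summits.BirchSwinnertonDyer.BirchSwinnertonDyer.Theses.TwistFamilyManinDescent
import Literature.NumberTheory.EllipticCurves.BSDRootNumberLocalTablesProofs
import Literature.NumberTheory.EllipticCurves.RootNumberProofs
import Literature.NumberTheory.EllipticCurves.CuspFormLFunctionLevelConductorProofs
import HarnessLib

/-!
# Route `TwistFamilyManinDescent`, LINE 16 (bsd-idea-3 g6), glue G16 `StrongIsUnstarredOfKummerFree`
# (stmt-BirchSwinnertonDyer-27338): modularity → S16a → S16b → K15a — PROVED BY NAME (the planner's Sketch16
# argument, tree theorems only; no stub, no named fact, no `sorry`)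

Cell `pub/bsd-wall`, D-0145 line `route-BirchSwinnertonDyer-TeichmullerTwistDescent`, seat `bsd-line-ttd-p1` g7,
working the planner-of-record's TFMD LINE 16. BSD is NOT proved by this; Manin's conjecture is not proved by this;
the engine S16b (`SupersingularKummerFreeStrongIsUnstarred`, stmt-27296) is OPEN and so K15a
(`SupersingularStrongIsUnstarred`, stmt-27072) and Ray57 (stmt-26325) stay open. This file closes ONLY the glue.

## Statement (verbatim the route decl)

`exists_isNewformOf → RaynaudRegimeClassNoLocalPTorsion → SupersingularKummerFreeStrongIsUnstarred →
SupersingularStrongIsUnstarred`.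

## Proof

K15a and S16b have the same binders except S16b's extra «Kummer-free class» hypothesis
`∀ W' ∼ W, W'(ℚ_p)[p] = 0`, which is S16a's conclusion; S16a wants `Addv W p`, which K15a's binders give through
modularity: the level of a parametrisation datum is the conductor (`IsNewformOf.level_eq_conductorNorm_of_exists_isNewformOf`,
Carayol / Diamond–Shurman 8.8.1 from `exists_isNewformOf`), and `p² ∣ N_E` iff additive reduction at the place over
`p` (`natGenerator_sq_dvd_conductorNorm_iff`, Silverman *ATAEC* IV.10.2(c)), read in the `Addv` currency through the
prime/place bridges (`hasGoodReductionAtPrime_iff_hasGoodReductionAt_holds`,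
`hasMultiplicativeReductionAtPrime_iff_hasMultiplicativeReductionAt_holds`). This is the planner's `Sketch16.lean`
(`addv_of_sq_dvd_level`, `glue16_proof`) landed verbatim in `Theorems/`.

References: [DiamondShurman2005] F. Diamond, J. Shurman, *A First Course in Modular Forms*, GTM 228, Thm. 8.8.1;
[Carayol1986] H. Carayol, Ann. Sci. ÉNS 19 (1986) 409–468; [SilvermanATAEC1994] J. H. Silverman, *Advanced Topics*,
GTM 151 (1994), IV.10.2(c); [SilvermanAEC2009] VII.5 Prop. 5.1. Design: theorems only; no definition, no named
fact, no `sorry`; axioms `propext`, `Classical.choice`, `Quot.sound`.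
-/

set_option autoImplicit false
-- the Theorems directory repeats the summit name (sibling precedent `TwistFamilyManinDescentRaynaudRegimeOfOrientation.lean`)
set_option linter.dupNamespace false

noncomputable section

open scoped Classical

namespace Summit.BirchSwinnertonDyer.BirchSwinnertonDyer.Theorems.TwistFamilyManinDescent

open WeierstrassCurve Literature.NumberTheory.EllipticCurves Literature.NumberTheory.EllipticCurves.ModularForms

/-- **`p² ∣ N` for the level `N` of a modular parametrisation datum of `W` ⟹ `W` is additive at `p`** (`Addv W p`:
neither good nor multiplicative), GIVEN modularity `exists_isNewformOf`: the level equals the conductor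
(`IsNewformOf.level_eq_conductorNorm_of_exists_isNewformOf`), `p² ∣ N_E ↔` additive reduction at the place over `p`
(`natGenerator_sq_dvd_conductorNorm_iff`), and additive excludes good and multiplicative (place ↔ prime bridges).
The planner's `Sketch16.addv_of_sq_dvd_level`. [cite: DiamondShurman2005, Thm. 8.8.1]
[cite: SilvermanATAEC1994, IV.10.2(c)] [cite: SilvermanAEC2009, VII.5 Prop. 5.1] -/
theorem addv_of_sq_dvd_level (hmod : exists_isNewformOf) (W : WeierstrassCurve ℚ) [W.IsElliptic]
    {N : ℕ} [NeZero N] (D : ModularParametrizationData W N) (p : ℕ) [hp : Fact p.Prime]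
    (hN : p ^ 2 ∣ N) : Literature.NumberTheory.EllipticCurves.Rank1Residual.Addv W p := by
  have hNc : N = W.conductorNorm ℤ :=
    IsNewformOf.level_eq_conductorNorm_of_exists_isNewformOf hmod D.isNewformOf
  set P : Nat.Primes := ⟨p, hp.out⟩ with hP
  set v : IsDedekindDomain.HeightOneSpectrum ℤ := (Rat.HeightOneSpectrum.primesEquiv (R := ℤ)).symm P
    with hv
  have hgen : Rat.HeightOneSpectrum.natGenerator v = p :=
    congrArg Subtype.val ((Rat.HeightOneSpectrum.primesEquiv (R := ℤ)).apply_symm_apply P)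
  have hadd : W.HasAdditiveReductionAt v := by
    rw [← natGenerator_sq_dvd_conductorNorm_iff v W, hgen]
    have : (p : ℤ) ^ 2 ∣ (N : ℤ) := by exact_mod_cast hN
    rw [hNc] at this
    exact_mod_cast this
  refine ⟨fun hg => ?_, fun hm => ?_⟩
  · exact ((W.hasGoodReductionAtPrime_iff_hasGoodReductionAt_holds P).mp hg).not_hasAdditiveReductionAt hadd
  · exact ((W.hasMultiplicativeReductionAtPrime_iff_hasMultiplicativeReductionAt_holds P).mp
      hm).not_hasAdditiveReductionAt hadd

/-- **G16 (LINE 16 glue, stmt-BirchSwinnertonDyer-27338) `StrongIsUnstarredOfKummerFree` — PROVED**: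
`exists_isNewformOf → RaynaudRegimeClassNoLocalPTorsion → SupersingularKummerFreeStrongIsUnstarred →
SupersingularStrongIsUnstarred`. K15a's binders are fed to the engine S16b, whose Kummer-free hypothesis is S16a's
conclusion at the same curve, S16a's additivity coming from `p² ∣ N` and modularity (`addv_of_sq_dvd_level`). Pure
composition (the planner's `Sketch16.glue16_proof`). No summit, rung or crux is proved by this; S16b, K15a, Ray57
stay open. [cite: DiamondShurman2005, Thm. 8.8.1] [cite: SilvermanATAEC1994, IV.10.2(c)] -/
theorem strongIsUnstarredOfKummerFree_proof :
    Summit.BirchSwinnertonDyer.BirchSwinnertonDyer.Theses.TwistFamilyManinDescent.StrongIsUnstarredOfKummerFree := by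
  intro hmod h16a h16b W _ _ N _ D p hp hrow hN hred htw hlat
  haveI : Fact p.Prime := ⟨hp⟩
  exact h16b W D p hrow hN hred htw (h16a W p hrow (addv_of_sq_dvd_level hmod W D p hN) htw) hlat

end Summit.BirchSwinnertonDyer.BirchSwinnertonDyer.Theorems.TwistFamilyManinDescent

end
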